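import Mathlib

/-!
# Deficient lever lemmas II — the norm through the Galois hull and the fibrewise sums

Line `orbit-interpolation-determinant` for the crux `ApproximationProperty` (stmt-Schanuel-6117, route
DiophantineDichotomy), registered sub-goal `orbitClusterBoundDeficient_of` (the DEFICIENT-RANK orbit
cluster bound, KERNEL-c8 §4 / KERNEL-c6 R1), proved in `…OrbitClusterBoundDeficient.lean`, which
imports this file. Everything here is PROVED; no definitions, no named facts. Registered sub-goals
carried by this file: `pow_absNorm_le_prod_norm_det`, `sum_sum_comp_eq`.

For `φ_a : K →+* L` (`a < r`, lifts of `r` complex embeddings of `K` into a number field `L`, the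
"Galois hull") and integral `y_j ∈ J ⊆ 𝓞_K`, the INTEGRAL MINOR `M = det (φ_a(y_j))_{a,j} ∈ 𝓞_L`:
* `map_det_mapRingHom`: `τ M = det ((τ ∘ φ_a)(y_j))` for every complex embedding `τ` of `L`.
* `pow_absNorm_le_prod_norm_det`: the ARITHMETIC LOWER BOUND replacing the discriminant of the
  full-rank lever — each Leibniz term of `M` takes one entry from every row, so
  `M ∈ ∏ₐ φ_a(J)𝓞_L`, `N(∏ₐ φ_a(J)𝓞_L) ∣ N(M𝓞_L) = |N_{L/ℚ}(M)| = ∏_τ |τ M|`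
  (`Ideal.absNorm_dvd_absNorm_of_le`, `Ideal.absNorm_span_singleton`, `Algebra.norm_eq_prod_embeddings`);
  with `N(φ_a(J)𝓞_L) = N(J)^e` this is `N(J)^{e r} ≤ ∏_τ |τ M|` when `M ≠ 0`.
* `sum_sum_comp_eq`, `sum_card_cluster_eq`: if every fibre of `τ ↦ τ ∘ φ_a` has `e` elements then
  `∑_τ ∑_a g(τ ∘ φ_a) = r e ∑_ρ g ρ` and, for `k` distinct targets `σ i`,
  `∑_τ #{a : τ ∘ φ_a ∈ {σ i}} = r k e` (`Finset.sum_fiberwise`, `Finset.card_eq_sum_card_fiberwise`).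
-/

open Finset Matrix NumberField Module

-- `Summit.Schanuel.Schanuel.…` is the mandated summit/sub-problem namespace (single-conjunct summit):
set_option linter.dupNamespace false

namespace Summit.Schanuel.Schanuel.Cruxes.ApproximationProperty.OrbitInterpolationDeterminant

/-- A complex embedding `τ` of `L` maps the INTEGRAL minor `det (φ_a(y_j))` (entries moved into
`𝓞 L` by `mapRingHom`) to the complex minor of the composed embeddings `τ ∘ φ_a` of `K`. -/
theorem map_det_mapRingHom {K L : Type*} [Field K] [NumberField K] [Field L] [NumberField L]
    {r : ℕ} (φ : Fin r → (K →+* L)) (yO : Fin r → 𝓞 K) (τ : L →+* ℂ) :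
    τ (((Matrix.of fun a j => RingOfIntegers.mapRingHom (φ a) (yO j)).det : 𝓞 L) : L) =
      (Matrix.of fun a j => (τ.comp (φ a)) ((yO j : 𝓞 K) : K)).det := by
  rw [RingOfIntegers.coe_eq_algebraMap, RingHom.map_det, RingHom.map_det]
  congr 1

/-- **Arithmetic lower bound through the Galois hull.** If the integral minor
`M = det (φ_a(y_j))_{a,j}` (`y_j ∈ J`, `φ_a : K → L`) is non-zero, it lies in the product ideal
`∏ₐ φ_a(J)𝓞_L`, so `N(J)^{e·r} ≤ |N_{L/ℚ}(M)| = ∏_τ |τ M|` as soon as every extended ideal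
`φ_a(J)𝓞_L` has norm `N(J)^e`. -/
theorem pow_absNorm_le_prod_norm_det : ∀ {K L : Type} [Field K] [NumberField K] [Field L] [NumberField L] {r : ℕ} (φ : Fin r → (K →+* L)) (J : Ideal (NumberField.RingOfIntegers K)) (e : ℕ), (∀ a, Ideal.absNorm (J.map (NumberField.RingOfIntegers.mapRingHom (φ a))) = Ideal.absNorm J ^ e) → ∀ (yO : Fin r → NumberField.RingOfIntegers K), (∀ j, yO j ∈ J) → (Matrix.of fun a j => NumberField.RingOfIntegers.mapRingHom (φ a) (yO j)).det ≠ 0 → ((Ideal.absNorm J : ℝ) ^ e) ^ r ≤ ∏ τ : L →+* ℂ, ‖τ (((Matrix.of fun a j => NumberField.RingOfIntegers.mapRingHom (φ a) (yO j)).det : NumberField.RingOfIntegers L) : L)‖ := by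
  intro K L _ _ _ _ r φ J e hJ yO hyO hdet
  classical
  set MO : Matrix (Fin r) (Fin r) (𝓞 L) :=
    Matrix.of fun a j => RingOfIntegers.mapRingHom (φ a) (yO j) with hMO
  -- `det MO` lies in the product of the extended ideals
  have hmem : MO.det ∈ ∏ a, J.map (RingOfIntegers.mapRingHom (φ a)) := by
    rw [Matrix.det_apply]
    refine Ideal.sum_mem _ fun π _ => ?_
    have hprod : ∏ i, MO (π i) i ∈ ∏ a, J.map (RingOfIntegers.mapRingHom (φ a)) := by
      have hre : ∏ i, MO (π i) i = ∏ a, MO a (π.symm a) := by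
        refine Fintype.prod_equiv π _ _ fun i => ?_
        simp
      rw [hre]
      exact Ideal.prod_mem_prod fun a _ => by
        simp only [hMO, Matrix.of_apply]
        exact Ideal.mem_map_of_mem _ (hyO _)
    rw [Units.smul_def, zsmul_eq_mul]
    exact Ideal.mul_mem_left _ _ hprod
  -- norms of ideals
  have hdvd := Ideal.absNorm_dvd_absNorm_of_le ((Ideal.span_singleton_le_iff_mem _).mpr hmem)
  rw [Ideal.absNorm_span_singleton, map_prod] at hdvd
  simp_rw [hJ] at hdvd
  rw [Finset.prod_const, Finset.card_univ, Fintype.card_fin] at hdvd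
  have hne : Algebra.norm ℤ MO.det ≠ 0 := Algebra.norm_ne_zero_iff.mpr hdet
  have hle := Nat.le_of_dvd (Int.natAbs_pos.mpr hne) hdvd
  -- `|N(M)| = ∏_τ |τ M|`
  have hprodC : (((Algebra.norm ℤ MO.det : ℤ) : ℚ) : ℂ) = ∏ τ : L →ₐ[ℚ] ℂ, τ (MO.det : L) := by
    rw [Algebra.coe_norm_int, ← Algebra.norm_eq_prod_embeddings ℚ ℂ ((MO.det : 𝓞 L) : L)]
    rfl
  have hR : (((Algebra.norm ℤ MO.det).natAbs : ℕ) : ℝ) = ∏ τ : L →+* ℂ, ‖τ (MO.det : L)‖ := by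
    have h2 := congrArg norm hprodC
    rw [norm_prod, Complex.norm_ratCast, Rat.cast_intCast] at h2
    rw [Nat.cast_natAbs, Int.cast_abs, h2]
    exact (Fintype.prod_equiv (RingHom.equivRatAlgHom : (L →+* ℂ) ≃ (L →ₐ[ℚ] ℂ)) _ _
      fun τ => rfl).symm
  calc ((Ideal.absNorm J : ℝ) ^ e) ^ r = (((Ideal.absNorm J ^ e) ^ r : ℕ) : ℝ) := by push_cast; ring
    _ ≤ (((Algebra.norm ℤ MO.det).natAbs : ℕ) : ℝ) := by exact_mod_cast hle
    _ = _ := hR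

/-- **Fibrewise sum I.** If every fibre of `τ ↦ τ ∘ φ_a` has `e` elements, then
`∑_τ ∑_a g(τ ∘ φ_a) = r · e · ∑_ρ g ρ`. -/
theorem sum_sum_comp_eq : ∀ {K L : Type} [Field K] [NumberField K] [Field L] [NumberField L] {r : ℕ} (φ : Fin r → (K →+* L)) (e : ℕ), (∀ a (ρ : K →+* ℂ), Nat.card {τ : L →+* ℂ // τ.comp (φ a) = ρ} = e) → ∀ (g : (K →+* ℂ) → ℝ), ∑ τ : L →+* ℂ, ∑ a, g (τ.comp (φ a)) = r * e * ∑ ρ : K →+* ℂ, g ρ := by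
  intro K L _ _ _ _ r φ e hfib g
  classical
  have hfib' : ∀ a (ρ : K →+* ℂ),
      (Finset.univ.filter (fun τ : L →+* ℂ => τ.comp (φ a) = ρ)).card = e := fun a ρ => by
    rw [← hfib a ρ]
    refine (Nat.subtype_card _ fun τ => ?_).symm
    simp
  rw [Finset.sum_comm]
  have key : ∀ a : Fin r, ∑ τ : L →+* ℂ, g (τ.comp (φ a)) = e * ∑ ρ : K →+* ℂ, g ρ := by
    intro a
    rw [← Finset.sum_fiberwise Finset.univ (fun τ : L →+* ℂ => τ.comp (φ a))
      (fun τ => g (τ.comp (φ a))), Finset.mul_sum]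
    refine Finset.sum_congr rfl fun ρ _ => ?_
    have hc : ∀ τ ∈ Finset.univ.filter (fun τ : L →+* ℂ => τ.comp (φ a) = ρ),
        g (τ.comp (φ a)) = g ρ := by
      intro τ hτ; rw [(Finset.mem_filter.mp hτ).2]
    rw [Finset.sum_congr rfl hc, Finset.sum_const, hfib', nsmul_eq_mul]
  simp_rw [key]
  rw [Finset.sum_const, Finset.card_univ, Fintype.card_fin, nsmul_eq_mul]
  ring

/-- **Fibrewise sum II.** With fibres of size `e` and `k` distinct target embeddings `σ i`,
the clustered rows counted over all `τ` number `∑_τ #{a : τ ∘ φ_a ∈ {σ i}} = r · k · e`. -/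
theorem sum_card_cluster_eq {K L : Type*} [Field K] [NumberField K] [Field L] [NumberField L]
    {r k : ℕ} (φ : Fin r → (K →+* L)) (e : ℕ)
    (hfib : ∀ a (ρ : K →+* ℂ), Nat.card {τ : L →+* ℂ // τ.comp (φ a) = ρ} = e)
    (σ : Fin k → (K →+* ℂ)) (hσ : Function.Injective σ)
    (S : (L →+* ℂ) → Finset (Fin r)) (hS : ∀ τ a, a ∈ S τ ↔ τ.comp (φ a) ∈ Set.range σ) :
    ∑ τ : L →+* ℂ, (S τ).card = r * k * e := by
  classical
  have hfib' : ∀ a (ρ : K →+* ℂ),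
      (Finset.univ.filter (fun τ : L →+* ℂ => τ.comp (φ a) = ρ)).card = e := fun a ρ => by
    rw [← hfib a ρ]
    refine (Nat.subtype_card _ fun τ => ?_).symm
    simp
  have h1 : ∀ τ : L →+* ℂ, (S τ).card = ∑ a, if τ.comp (φ a) ∈ Set.range σ then 1 else 0 := by
    intro τ
    have : S τ = Finset.univ.filter (fun a => τ.comp (φ a) ∈ Set.range σ) := by
      ext a; simp [hS]
    rw [this, Finset.card_filter]
  simp_rw [h1]
  rw [Finset.sum_comm]
  have h2 : ∀ a : Fin r, (∑ τ : L →+* ℂ, if τ.comp (φ a) ∈ Set.range σ then 1 else 0) = k * e := by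
    intro a
    rw [← Finset.card_filter]
    rw [Finset.card_eq_sum_card_fiberwise (f := fun τ : L →+* ℂ => τ.comp (φ a))
      (t := Finset.univ.image σ) ?_]
    · rw [Finset.sum_image (fun i _ i' _ h => hσ h)]
      have h3 : ∀ i : Fin k, ((Finset.univ.filter
          (fun τ : L →+* ℂ => τ.comp (φ a) ∈ Set.range σ)).filter
            (fun τ => τ.comp (φ a) = σ i)).card = e := by
        intro i
        rw [Finset.filter_filter]
        have h4 : ∀ τ : L →+* ℂ, (τ.comp (φ a) ∈ Set.range σ ∧ τ.comp (φ a) = σ i) ↔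
            τ.comp (φ a) = σ i :=
          fun τ => ⟨fun h => h.2, fun h => ⟨⟨i, h.symm⟩, h⟩⟩
        simp_rw [h4]
        exact hfib' a (σ i)
      simp_rw [h3]
      rw [Finset.sum_const, Finset.card_univ, Fintype.card_fin, smul_eq_mul]
    · intro τ hτ
      obtain ⟨i, hi⟩ := (Finset.mem_filter.mp (Finset.mem_coe.mp hτ)).2
      exact Finset.mem_coe.mpr (Finset.mem_image.mpr ⟨i, Finset.mem_univ _, hi⟩)
  simp_rw [h2]
  rw [Finset.sum_const, Finset.card_univ, Fintype.card_fin, smul_eq_mul]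
  ring

end Summit.Schanuel.Schanuel.Cruxes.ApproximationProperty.OrbitInterpolationDeterminant
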